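import Summits.QuantumFields.YangMills.Theorems.BalabanUVNodesN19RekeyingCalculus
import Summits.QuantumFields.YangMills.Theorems.BalabanUVNodesN19CoreMetric

/-!
# BalabanUVNodes ∕ node N19 (NE7) — THE RE-KEYING CALCULUS, PART II: ASCENT.  The exact price of moving node U5's binder list
# (`Spine.NE7.Core`, `T4IndicatorShell.ShellWeightBound`, `T4MatchingAssembly.HybridNE7`) from a COARSE class key UP to a FINER one:
# a summable, CONSTANT-FREE intra-fibre homogeneity of the log-ratio of the two runs' cores — and nothing else

Cell `pub-ymgap` (HUMAN RULING D-0062 Track A ∕ D-0149 width seats), WIDTH SEAT `pub-ymgap-dag-n19-w1` (node n19 = NE7, seat 1 of 3), generation g3,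
INTENT-1 (bus CLAIM 2026-08-28T03:06Z).  Route `Summits/QuantumFields/YangMills/Theses/BalabanUVNodes.lean`, key item K3⁷ `SpineGivenEndpointR13SepCoPH`
(stmt-QuantumFields-20544); filed `--kind proof --supports … --as helper`.  COUNT-NEUTRAL.  THEOREMS ONLY (0 `def`, 0 `sorry`).  ADDITIVE — imports this seat's
g2 `…Theorems.BalabanUVNodesN19RekeyingCalculus` (p593255: `classVal_apply`, `classVal_sub_fun`, `classVal_collapse`, `relWeightBound_of_classVal`, `core_classVal`,
`coreEdge_classVal`) and dag-n19-e's `…Theorems.BalabanUVNodesN19CoreMetric` (p462782: `exists_center_of_pairwise_le`, `abs_log_sub_log_sub_le_of_sandwich`,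
`core_of_subset`) — all CITED BY NAME; modifies nothing.

WHY.  Part I (g2) recorded what survives a re-keying of BOTH runs along a class map `π K : σ → ι` (node U5d's partial summation
`classVal S π a K t τ = Σ_{s ∈ S K, π K s = τ} a K t s`): `Core` and `ShellWeightBound` always DESCEND (same `c_K`, same `δ`, same `Wsh`), `RelWeightBound`
descends ∕ ascends under pull-back ∕ cover, and — the reading handed to the planner — «NOTHING ascends to a finer key except `RelWeightBound`; the key resolution
at which `Core` is PRODUCED is the whole of N19's content» (witness: g0's `exists_totalCore_not_core`, the collapse `Bool → Unit`).  This file prices the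
ascent EXACTLY.  Write `Bad♭ K t := (S K).filter (π K · ∈ Bad K t)` for the PULL-BACK of the coarse bad class and call a fine pair of core families `p`
(run A), `q` (run B) FIBREWISE-MATCHED at rate `ε` when
  `Fib(ε)`: on every coarse-GOOD fibre `{s ∈ S K : π K s = τ}`, `τ ∈ T K ∖ Bad K t`, `|t| ≤ l₀`, there is a constant `r = r(K, t, τ)` — FREE to depend on
  the source value AND on the class — with `e^{r − vol·ε_K}·p ≤ q ≤ e^{r + vol·ε_K}·p` termwise on the fibre
(stated inline in `Core`'s own binder style; no definition).  `Fib` carries NO matching constant: for positive cores it says exactly that, fibre by fibre and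
source value by source value, the log-ratio `log q − log p` has pairwise oscillation `≤ 2·vol·ε_K` (§4).  THE PRICE OF ASCENT IS `Fib`:
* §1 [folklore] two lemmas of real arithmetic: a fibrewise sandwich SUMS to a sandwich of the fibre sums (`sandwich_sum`); two sandwiches of ONE pair with
  positive left member pin their constants to each other (`abs_sub_le_of_two_sandwiches`); the degenerate fibre (`sandwich_of_eq_zero`).
* §2 [folklore] ★ `shellWeightBound_of_classVal` — NE7c ASCENDS for free given the fine termwise letters `0 ≤ sh ≤ term` (the totals agree; Part I's
  promised twin of `shellWeightBound_classVal`).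
* §3 [folklore] ★★ `core_of_core_classVal` — ASCENT OF `Core`: coarse `Core l₀ vol T Bad (classVal S π p) (classVal S π q) δ`, `Fib(ε)`, `p ≥ 0`, `π K : S K → T K`
  ⇒ fine `Core l₀ vol S Bad♭ p q (δ + 2ε)` WITH THE COARSE CONSTANTS `c_K` (on a coarse-good fibre the summed fibrewise sandwich and the coarse sandwich squeeze
  the SAME positive pair `(classVal p, classVal q)`, whence `|r − c_K| ≤ vol(δ_K + ε_K)`; a fibre of zero run-A mass is matched trivially) — NO saturation
  hypothesis, NO positivity of run B · `coreEdge_of_coreEdge_classVal` (leaf D's `hedge ∕ h19` shape `∃ δ, Core ∧ Summable δ` ASCENDS given `∃ ε, Fib ε ∧ Summable ε`) ·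
  ★ `fibrewise_of_core` (NECESSITY: fine `Core δ` whose bad class is covered by `Bad` ⇒ `Fib(δ)` with `r := c_K`) · ★★ `coreEdge_iff_classVal_fibrewise` (AT THE
  PULL-BACK BAD CLASS, `p ≥ 0`: the fine edge ⟺ the coarse edge ∧ a summable `Fib` — Part I's `coreEdge_classVal` is the first conjunct of ⇒).
* §4 [folklore] ★ `fibrewise_of_fibreOsc` ∕ `fibreOsc_of_fibrewise` ∕ `fibrewise_iff_fibreOsc` (positive cores: `Fib(ε)` ⟺ intra-fibre pairwise oscillation of the
  log-ratio `≤ 2·vol·ε_K` at each source value — `N19CoreMetric`'s midpoint lemma BY NAME, now PER FIBRE AND PER SOURCE VALUE instead of globally) ·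
  `core_of_core_classVal_of_fibreOsc`.
* §5 [folklore] THE COLLAPSE INSTANCE `σ → Unit` ★★ `core_of_totals_of_classOsc`: a t-UNIFORM one-constant sandwich of the TOTALS `Σ_S p`, `Σ_S q` (node U5's DECL-target
  currency `MatchingModConstants` read at one class, `N27xAtSpineCarriers.core_singleton_iff_matchingModConstants`) PLUS, at each source value SEPARATELY, a
  class-oscillation of the log-ratio `≤ 2·vol·ε_K` ⇒ `Core l₀ vol S ∅ p q (δ + 2ε)`.  So what `Core` asks BEYOND the matching of the totals is PER-SOURCE
  CLASS-HOMOGENEITY and nothing else — the source-uniformity of the constants is carried entirely by the totals (compare `N19CoreMetric.core_iff_logRatio_osc_le`: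
  oscillation JOINT in `(t, τ)`; here the joint demand is split into «totals, uniform in t» × «classes, t by t»; g0's `exists_totalCore_not_core` is the case
  of a non-summable class oscillation) · `coreEdge_of_totals_of_classOsc`.
* §6 [folklore] ★ `core_of_partwise` — GLUING ACROSS A PARTITION: `Core`-type sandwiches produced SEPARATELY on the parts `π K ⁻¹ τ` of the class set, each
  part with its OWN (t-uniform or not) constants, glue to a global `Core (η + 2δ)` as soon as the PART-SUMS match modulo ONE constant (`Core` of the part-sums,
  rate `η`) — the printed two-class template is King's small-field ∕ large-field split [King1986] (3.10)–(3.13) pp. 656–657 (context only, nothing cited as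
  stating this); the converse (global ⇒ partwise with the global constants, and ⇒ `Core` of the part-sums) is `fibrewise_of_core` ∕ Part I's `core_classVal`.
* §7 [folklore] ★★ `hybridNE7_of_classVal` — ASCENT OF THE WHOLE BINDER LIST: coarse `HybridNE7 l₀ vol T (classVal a) (classVal b) Bad W (classVal sha) (classVal shb)
  Wsh δ` + the fine termwise shell letters + `Fib(ε)` on the fine CORES `a − sha`, `b − shb` + `Summable ε` ⇒ fine `HybridNE7 l₀ vol S a b Bad♭ W sha shb Wsh (δ + 2ε)`
  (weight: Part I's `relWeightBound_of_classVal`; shell: §2; core: §3 through Part I's `classVal_sub_fun`).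
READINGS (for the planner; located, nothing proposed).  (i) With Part I: along any class map the N19′ slot `∃δ, Core ∧ Summable δ` at the FINE key ⟺ the
same slot at the COARSE key ∧ a summable `Fib` — so a closing proof of K3⁷ v4 stub 2's N19′ conjunct at the reading's key `Σ K, SiteSeqKey F (K₀ + K)` may
produce `Core` at the COARSEST convenient key (the large-field skeleton classes; King's two classes; at the extreme the totals, i.e. node U5's DECL target)
plus ONE constant-free homogeneity letter per coarse class, and these two tasks are independent.  (ii) With dag-n19-e's source split (`…N19SourceSplit`:
`Core` ⟺ (V) class-uniform vacuum matching ∧ (I) per-class constant-free source response) the demand «ONE constant `c_K`, uniform in `(t, τ)`» factors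
through a 2 × 2 grid — (vacuum ∕ insertion) × (coarse ∕ intra-fibre) — in which exactly ONE cell carries a named constant: the vacuum matching of the
coarse classes.  (iii) `ShellWeightBound` is key-resolution-free given the termwise letters (§2 with Part I §4), like `RelWeightBound` under saturation
(Part I §3): of the five fields of `HybridNE7` only `core` is key-sensitive, and its key-sensitivity is `Fib`.

HONEST FRAMING.  Finite-sum ∕ elementary real-analysis bookkeeping [folklore] over the tree's SHAPES; `Fib`, `Core`, `ShellWeightBound`, `HybridNE7` and the
partwise ∕ totals sandwiches occur as HYPOTHESES only; nothing of Bałaban's is asserted or instantiated; no estimate of the programme is proved.  NE7 ∕ NE7b ∕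
NE7c are NOT PRINTED as two-run statements for d = 4 ([Balaban1987RG1]–[Balaban1989LargeFieldII] bound ONE run uniformly in `ε`; [King1986] (3.10)–(3.13) is a
d = 2, 3 TEMPLATE, context only) and NOT proved; N19 NOT discharged (0∕1); K3⁷ OPEN, not claimed; counts UNMOVED (typed 28∕28 · discharged 5∕27, A 5∕28).
Everything below is PROVED (0 `sorry`, 0 named facts, standard axioms); no decl carries a cite tag.  One finite four-torus programme at fixed ε — NOT ℝ⁴, NOT
infinite volume, NOT OS, NOT a mass gap, NOT the Clay problem (R4 closes the conditional finite-𝕋⁴ rung `BalabanLadder.UV` only).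
-/

noncomputable section

namespace Summit.QuantumFields.YangMills.BalabanUVNodes.N19RekeyingAscent

open Finset
open Summit.QuantumFields.BalabanUV.T4Continuum.Spine.NE7 (Core sandwich_of_abs_log_sub_le)
open Literature.MathematicalPhysics.QuantumFieldTheory.Balaban1983to89
open T4WeightBudget (RelWeightBound)
open T4IndicatorShell (ShellWeightBound)
open T4MatchingAssembly (HybridNE7 classVal sum_classVal classVal_nonneg)
open Summit.QuantumFields.YangMills.BalabanUVNodes.N19RekeyingCalculus (classVal_apply classVal_sub_fun classVal_collapse relWeightBound_of_classVal
  core_classVal coreEdge_classVal)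
open Summit.QuantumFields.YangMills.BalabanUVNodes.N19CoreMetric (exists_center_of_pairwise_le abs_log_sub_log_sub_le_of_sandwich core_of_subset)

variable {σ ι : Type*} [DecidableEq ι]

/-! ## §1 Real arithmetic of two-sided sandwiches [folklore] -/

section Arithmetic

/-- A FIBREWISE SANDWICH SUMS: `lo·p_s ≤ q_s ≤ hi·p_s` termwise on a finite set gives `lo·Σp ≤ Σq ≤ hi·Σp` — where the constant `r` of `Fib`, uniform along the fibre,
is consumed (exactly as Part I's `core_classVal` consumes the class-uniformity of `c_K`). [folklore] -/
theorem sandwich_sum {F : Finset σ} {p q : σ → ℝ} {lo hi : ℝ} (h : ∀ s ∈ F, lo * p s ≤ q s ∧ q s ≤ hi * p s) :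
    lo * ∑ s ∈ F, p s ≤ ∑ s ∈ F, q s ∧ ∑ s ∈ F, q s ≤ hi * ∑ s ∈ F, p s := by
  rw [Finset.mul_sum, Finset.mul_sum]
  exact ⟨Finset.sum_le_sum fun s hs => (h s hs).1, Finset.sum_le_sum fun s hs => (h s hs).2⟩

/-- TWO SANDWICHES OF ONE PAIR PIN THEIR CONSTANTS: if `e^{r ∓ η}·P` and `e^{c ∓ η′}·P` both sandwich the same `Q` and `0 < P`, then `|r − c| ≤ η + η′`. [folklore] -/
theorem abs_sub_le_of_two_sandwiches {P Q r c η η' : ℝ} (hP : 0 < P)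
    (h₁ : Real.exp (r - η) * P ≤ Q) (h₁' : Q ≤ Real.exp (r + η) * P)
    (h₂ : Real.exp (c - η') * P ≤ Q) (h₂' : Q ≤ Real.exp (c + η') * P) :
    |r - c| ≤ η + η' := by
  have a : Real.exp (r - η) ≤ Real.exp (c + η') := le_of_mul_le_mul_right (h₁.trans h₂') hP
  have b : Real.exp (c - η') ≤ Real.exp (r + η) := le_of_mul_le_mul_right (h₂.trans h₁') hP
  rw [Real.exp_le_exp] at a b
  exact abs_le.mpr ⟨by linarith, by linarith⟩

/-- THE DEGENERATE FIBRE: a term with `p = 0` sandwiched at some constants (`q = 0` follows) is sandwiched at ANY constants. [folklore] -/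
theorem sandwich_of_eq_zero {p q lo hi lo' hi' : ℝ} (hp : p = 0) (h : lo * p ≤ q ∧ q ≤ hi * p) :
    lo' * p ≤ q ∧ q ≤ hi' * p := by
  subst hp
  simp only [mul_zero] at h ⊢
  exact h

/-- Widening the radius of a sandwich at a non-negative left member: `|r − c| ≤ η′` and `e^{r ∓ η}·p ≤ q ≤ …` give `e^{c ∓ (η′ + η)}·p ≤ q ≤ …`. [folklore] -/
theorem sandwich_widen {p q r c η η' : ℝ} (hp : 0 ≤ p) (hrc : |r - c| ≤ η')
    (h : Real.exp (r - η) * p ≤ q ∧ q ≤ Real.exp (r + η) * p) :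
    Real.exp (c - (η' + η)) * p ≤ q ∧ q ≤ Real.exp (c + (η' + η)) * p := by
  obtain ⟨hlo, hhi⟩ := abs_le.mp hrc
  exact ⟨(mul_le_mul_of_nonneg_right (Real.exp_le_exp.mpr (by linarith)) hp).trans h.1,
    h.2.trans (mul_le_mul_of_nonneg_right (Real.exp_le_exp.mpr (by linarith)) hp)⟩

end Arithmetic

/-! ## §2 `ShellWeightBound` (NE7c) ASCENDS for free given the fine termwise letters [folklore] -/

section Shell
variable {l₀ : ℝ} {S : ℕ → Finset σ} {T : ℕ → Finset ι} {π : ℕ → σ → ι} {a b sha shb : ℕ → ℝ → σ → ℝ} {Wsh : ℕ → ℝ}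

/-- **★ NE7c ASCENDS** [folklore]: a shell weight bound for the FIBRE SUMS at the coarse key, a class map into `T`, and the fine termwise letters `0 ≤ sha ≤ a`,
`0 ≤ shb ≤ b` on `S K` ⇒ the shell weight bound at the fine key with the SAME `Wsh` (the two totals `Σ sh`, `Σ term` are unchanged by partial summation —
`T4MatchingAssembly.sum_classVal` BY NAME).  With Part I's `shellWeightBound_classVal`: NE7c is KEY-RESOLUTION-FREE given the termwise letters. -/
theorem shellWeightBound_of_classVal (h : ShellWeightBound l₀ T (classVal S π a) (classVal S π b) (classVal S π sha) (classVal S π shb) Wsh)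
    (hmaps : ∀ K, ∀ s ∈ S K, π K s ∈ T K)
    (ha0 : ∀ (K : ℕ) (t : ℝ), |t| ≤ l₀ → ∀ s ∈ S K, 0 ≤ sha K t s) (ha1 : ∀ (K : ℕ) (t : ℝ), |t| ≤ l₀ → ∀ s ∈ S K, sha K t s ≤ a K t s)
    (hb0 : ∀ (K : ℕ) (t : ℝ), |t| ≤ l₀ → ∀ s ∈ S K, 0 ≤ shb K t s) (hb1 : ∀ (K : ℕ) (t : ℝ), |t| ≤ l₀ → ∀ s ∈ S K, shb K t s ≤ b K t s) :
    ShellWeightBound l₀ S a b sha shb Wsh where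
  nonneg := h.nonneg
  summable := h.summable
  sh_nonneg_left := ha0
  sh_le_left := ha1
  sh_nonneg_right := hb0
  sh_le_right := hb1
  left K t ht := by
    have h1 := h.left K t ht
    rwa [sum_classVal (hmaps K), sum_classVal (hmaps K)] at h1
  right K t ht := by
    have h1 := h.right K t ht
    rwa [sum_classVal (hmaps K), sum_classVal (hmaps K)] at h1

end Shell

/-! ## §3 `Core` ASCENDS at the price of a fibrewise matching with free constants [folklore] -/

section CoreAscent
variable [DecidableEq σ] {l₀ vol : ℝ} {S : ℕ → Finset σ} {T : ℕ → Finset ι} {π : ℕ → σ → ι} {p q : ℕ → ℝ → σ → ℝ}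
  {SBad : ℕ → ℝ → Finset σ} {Bad : ℕ → ℝ → Finset ι} {δ ε : ℕ → ℝ}

/-- **★★ ASCENT OF `Core`** [folklore].  Coarse `Core` for the fibre sums (ONE constant `c_K` per `K`), a class map into `T`, non-negative run-A terms, and the
FIBREWISE letter `Fib(ε)` — on every coarse-good fibre a sandwich `e^{r − vol·ε_K}·p ≤ q ≤ e^{r + vol·ε_K}·p` with `r = r(K,t,τ)` FREE — give fine `Core` at the
PULL-BACK bad class `Bad♭ K t = {s ∈ S K : π K s ∈ Bad K t}` with rate `δ + 2ε` and the COARSE constants: summing `Fib` over the fibre (§1) and comparing with the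
coarse sandwich of the same positive pair `(classVal p, classVal q)` pins `|r − c_K| ≤ vol(ε_K + δ_K)`; a fibre of zero run-A mass has `q = 0` termwise and is matched at
any constant.  NO saturation hypothesis, NO positivity of run B, NO `Bad ⊆ T`. -/
theorem core_of_core_classVal (hmaps : ∀ K, ∀ s ∈ S K, π K s ∈ T K) (hp : ∀ (K : ℕ) (t : ℝ), |t| ≤ l₀ → ∀ s ∈ S K, 0 ≤ p K t s)
    (hC : Core l₀ vol T Bad (classVal S π p) (classVal S π q) δ)
    (hF : ∀ (K : ℕ) (t : ℝ), |t| ≤ l₀ → ∀ τ ∈ T K \ Bad K t, ∃ r : ℝ, ∀ s ∈ (S K).filter (fun s => π K s = τ),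
      Real.exp (r - vol * ε K) * p K t s ≤ q K t s ∧ q K t s ≤ Real.exp (r + vol * ε K) * p K t s) :
    Core l₀ vol S (fun K t => (S K).filter fun s => π K s ∈ Bad K t) p q (fun K => δ K + 2 * ε K) := by
  intro K
  obtain ⟨c, hc⟩ := hC K
  refine ⟨c, fun t ht s hs => ?_⟩
  obtain ⟨hsS, hsB⟩ := Finset.mem_sdiff.mp hs
  have hτ : π K s ∈ T K \ Bad K t := Finset.mem_sdiff.mpr ⟨hmaps K s hsS, fun hb => hsB (Finset.mem_filter.mpr ⟨hsS, hb⟩)⟩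
  obtain ⟨r, hr⟩ := hF K t ht (π K s) hτ
  have hsF : s ∈ (S K).filter (fun s' => π K s' = π K s) := Finset.mem_filter.mpr ⟨hsS, rfl⟩
  have hfib := sandwich_sum hr
  rw [← classVal_apply S π p K t (π K s), ← classVal_apply S π q K t (π K s)] at hfib
  have hcoarse := hc t ht (π K s) hτ
  have hring : vol * (δ K + 2 * ε K) = (vol * ε K + vol * δ K) + vol * ε K := by ring
  rw [hring]
  rcases (classVal_nonneg (hp K t ht) (π K s) : 0 ≤ classVal S π p K t (π K s)).eq_or_lt with hP0 | hPpos
  · have hps : p K t s = 0 :=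
      (Finset.sum_eq_zero_iff_of_nonneg fun s' hs' => hp K t ht s' (Finset.mem_filter.mp hs').1).mp
        (by rw [← classVal_apply S π p K t (π K s)]; exact hP0.symm) s hsF
    exact sandwich_of_eq_zero hps (hr s hsF)
  · exact sandwich_widen (hp K t ht s hsS) (abs_sub_le_of_two_sandwiches hPpos hfib.1 hfib.2 hcoarse.1 hcoarse.2) (hr s hsF)

/-- **LEAF D's `hedge ∕ h19` SHAPE ASCENDS** [folklore]: the coarse edge `∃ δ, Core ∧ Summable δ` and a SUMMABLE fibrewise letter `∃ ε, Fib ε ∧ Summable ε` give the fine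
edge at the pull-back bad class. -/
theorem coreEdge_of_coreEdge_classVal (hmaps : ∀ K, ∀ s ∈ S K, π K s ∈ T K) (hp : ∀ (K : ℕ) (t : ℝ), |t| ≤ l₀ → ∀ s ∈ S K, 0 ≤ p K t s)
    (hC : ∃ δ : ℕ → ℝ, Core l₀ vol T Bad (classVal S π p) (classVal S π q) δ ∧ Summable δ)
    (hF : ∃ ε : ℕ → ℝ, (∀ (K : ℕ) (t : ℝ), |t| ≤ l₀ → ∀ τ ∈ T K \ Bad K t, ∃ r : ℝ, ∀ s ∈ (S K).filter (fun s => π K s = τ),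
      Real.exp (r - vol * ε K) * p K t s ≤ q K t s ∧ q K t s ≤ Real.exp (r + vol * ε K) * p K t s) ∧ Summable ε) :
    ∃ δ : ℕ → ℝ, Core l₀ vol S (fun K t => (S K).filter fun s => π K s ∈ Bad K t) p q δ ∧ Summable δ := by
  obtain ⟨δ, hC, hδ⟩ := hC
  obtain ⟨ε, hF, hε⟩ := hF
  exact ⟨fun K => δ K + 2 * ε K, core_of_core_classVal hmaps hp hC hF, hδ.add (hε.mul_left 2)⟩

/-- **★ NECESSITY OF `Fib`** [folklore]: fine `Core δ` whose bad class is COVERED by the coarse one («`s ∈ SBad K t ⇒ π K s ∈ Bad K t`», automatic at the pull-back)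
gives `Fib(δ)` with the fine constants `r := c_K` — uniform in `(t, τ)`, more than `Fib` asks. -/
theorem fibrewise_of_core (hC : Core l₀ vol S SBad p q δ)
    (hcover : ∀ (K : ℕ) (t : ℝ), |t| ≤ l₀ → ∀ s ∈ S K, s ∈ SBad K t → π K s ∈ Bad K t) :
    ∀ (K : ℕ) (t : ℝ), |t| ≤ l₀ → ∀ τ ∈ T K \ Bad K t, ∃ r : ℝ, ∀ s ∈ (S K).filter (fun s => π K s = τ),
      Real.exp (r - vol * δ K) * p K t s ≤ q K t s ∧ q K t s ≤ Real.exp (r + vol * δ K) * p K t s := by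
  intro K t ht τ hτ
  obtain ⟨c, hc⟩ := hC K
  refine ⟨c, fun s hs => hc t ht s ?_⟩
  obtain ⟨hsS, hπ⟩ := Finset.mem_filter.mp hs
  exact Finset.mem_sdiff.mpr ⟨hsS, fun hb => (Finset.mem_sdiff.mp hτ).2 (hπ ▸ hcover K t ht s hsS hb)⟩

/-- `fibrewise_of_core` at the pull-back bad class — no side condition. [folklore] -/
theorem fibrewise_of_core_pullback (hC : Core l₀ vol S (fun K t => (S K).filter fun s => π K s ∈ Bad K t) p q δ) :
    ∀ (K : ℕ) (t : ℝ), |t| ≤ l₀ → ∀ τ ∈ T K \ Bad K t, ∃ r : ℝ, ∀ s ∈ (S K).filter (fun s => π K s = τ),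
      Real.exp (r - vol * δ K) * p K t s ≤ q K t s ∧ q K t s ≤ Real.exp (r + vol * δ K) * p K t s :=
  fibrewise_of_core hC fun _ _ _ _ _ hb => (Finset.mem_filter.mp hb).2

/-- **★★ THE FINE EDGE ⟺ THE COARSE EDGE ∧ A SUMMABLE `Fib`** [folklore] (at the pull-back bad class, non-negative run-A terms, class map into `T`): N19's slot
`∃ δ, Core ∧ Summable δ` at the FINE key is EQUIVALENT to the same slot at the COARSE key together with a summable fibrewise letter.  ⇒: Part I's `coreEdge_classVal`
(descent; the pull-back is covered by construction) and `fibrewise_of_core`; ⇐: `coreEdge_of_coreEdge_classVal`.  The price of ascent, exactly. -/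
theorem coreEdge_iff_classVal_fibrewise (hmaps : ∀ K, ∀ s ∈ S K, π K s ∈ T K) (hp : ∀ (K : ℕ) (t : ℝ), |t| ≤ l₀ → ∀ s ∈ S K, 0 ≤ p K t s) :
    (∃ δ : ℕ → ℝ, Core l₀ vol S (fun K t => (S K).filter fun s => π K s ∈ Bad K t) p q δ ∧ Summable δ) ↔
      (∃ δ : ℕ → ℝ, Core l₀ vol T Bad (classVal S π p) (classVal S π q) δ ∧ Summable δ) ∧
      ∃ ε : ℕ → ℝ, (∀ (K : ℕ) (t : ℝ), |t| ≤ l₀ → ∀ τ ∈ T K \ Bad K t, ∃ r : ℝ, ∀ s ∈ (S K).filter (fun s => π K s = τ),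
        Real.exp (r - vol * ε K) * p K t s ≤ q K t s ∧ q K t s ≤ Real.exp (r + vol * ε K) * p K t s) ∧ Summable ε := by
  refine ⟨fun h => ⟨coreEdge_classVal h fun K _ _ _ _ hb => (Finset.mem_filter.mp hb).2, ?_⟩, fun h => coreEdge_of_coreEdge_classVal hmaps hp h.1 h.2⟩
  obtain ⟨δ, hC, hδ⟩ := h
  exact ⟨δ, fibrewise_of_core_pullback hC, hδ⟩

end CoreAscent

/-! ## §4 The fibrewise letter in oscillation form: NO constant to name [folklore] -/

section Oscillation
variable {l₀ vol : ℝ} {S : ℕ → Finset σ} {T : ℕ → Finset ι} {π : ℕ → σ → ι} {p q : ℕ → ℝ → σ → ℝ}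
  {Bad : ℕ → ℝ → Finset ι} {δ ε : ℕ → ℝ}

/-- **★ `Fib` FROM INTRA-FIBRE OSCILLATION** [folklore]: positive cores on the coarse-good fibres whose log-ratio `log q − log p` has, on every such fibre and AT EACH
SOURCE VALUE, pairwise oscillation `≤ 2·vol·ε_K` are fibrewise-matched at rate `ε` — `r(K,t,τ)` := the centre of the fibre's log-ratios
(`N19CoreMetric.exists_center_of_pairwise_le`), then `NE7.sandwich_of_abs_log_sub_le` BY NAME. -/
theorem fibrewise_of_fibreOsc
    (hp : ∀ (K : ℕ) (t : ℝ), |t| ≤ l₀ → ∀ τ ∈ T K \ Bad K t, ∀ s ∈ (S K).filter (fun s => π K s = τ), 0 < p K t s)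
    (hq : ∀ (K : ℕ) (t : ℝ), |t| ≤ l₀ → ∀ τ ∈ T K \ Bad K t, ∀ s ∈ (S K).filter (fun s => π K s = τ), 0 < q K t s)
    (hosc : ∀ (K : ℕ) (t : ℝ), |t| ≤ l₀ → ∀ τ ∈ T K \ Bad K t, ∀ s ∈ (S K).filter (fun s => π K s = τ), ∀ s' ∈ (S K).filter (fun s => π K s = τ),
      (Real.log (q K t s) - Real.log (p K t s)) - (Real.log (q K t s') - Real.log (p K t s')) ≤ 2 * (vol * ε K)) :
    ∀ (K : ℕ) (t : ℝ), |t| ≤ l₀ → ∀ τ ∈ T K \ Bad K t, ∃ r : ℝ, ∀ s ∈ (S K).filter (fun s => π K s = τ),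
      Real.exp (r - vol * ε K) * p K t s ≤ q K t s ∧ q K t s ≤ Real.exp (r + vol * ε K) * p K t s := by
  intro K t ht τ hτ
  obtain ⟨r, hr⟩ := exists_center_of_pairwise_le
    (s := {x : ℝ | ∃ s ∈ (S K).filter (fun s => π K s = τ), x = Real.log (q K t s) - Real.log (p K t s)}) (η := vol * ε K) (by
      rintro x ⟨s, hs, rfl⟩ y ⟨s', hs', rfl⟩
      exact sub_le_iff_le_add'.mp (hosc K t ht τ hτ s hs s' hs'))
  exact ⟨r, fun s hs => sandwich_of_abs_log_sub_le (hp K t ht τ hτ s hs) (hq K t ht τ hτ s hs) (hr _ ⟨s, hs, rfl⟩)⟩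

/-- **… AND CONVERSELY** [folklore]: a fibrewise matching at rate `ε` of cores with positive run-A members bounds the intra-fibre oscillation of the log-ratio by
`2·vol·ε_K` (`N19CoreMetric.abs_log_sub_log_sub_le_of_sandwich` twice). -/
theorem fibreOsc_of_fibrewise
    (hp : ∀ (K : ℕ) (t : ℝ), |t| ≤ l₀ → ∀ τ ∈ T K \ Bad K t, ∀ s ∈ (S K).filter (fun s => π K s = τ), 0 < p K t s)
    (hF : ∀ (K : ℕ) (t : ℝ), |t| ≤ l₀ → ∀ τ ∈ T K \ Bad K t, ∃ r : ℝ, ∀ s ∈ (S K).filter (fun s => π K s = τ),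
      Real.exp (r - vol * ε K) * p K t s ≤ q K t s ∧ q K t s ≤ Real.exp (r + vol * ε K) * p K t s) :
    ∀ (K : ℕ) (t : ℝ), |t| ≤ l₀ → ∀ τ ∈ T K \ Bad K t, ∀ s ∈ (S K).filter (fun s => π K s = τ), ∀ s' ∈ (S K).filter (fun s => π K s = τ),
      (Real.log (q K t s) - Real.log (p K t s)) - (Real.log (q K t s') - Real.log (p K t s')) ≤ 2 * (vol * ε K) := by
  intro K t ht τ hτ s hs s' hs'
  obtain ⟨r, hr⟩ := hF K t ht τ hτ
  have h1 := abs_le.mp (abs_log_sub_log_sub_le_of_sandwich (hp K t ht τ hτ s hs) (hr s hs).1 (hr s hs).2)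
  have h2 := abs_le.mp (abs_log_sub_log_sub_le_of_sandwich (hp K t ht τ hτ s' hs') (hr s' hs').1 (hr s' hs').2)
  linarith [h1.2, h2.1]

/-- **`Fib(ε)` ⟺ INTRA-FIBRE OSCILLATION `≤ 2·vol·ε_K` AT EACH SOURCE VALUE** on positive cores [folklore]: the price of ascent with no constant to name. -/
theorem fibrewise_iff_fibreOsc
    (hp : ∀ (K : ℕ) (t : ℝ), |t| ≤ l₀ → ∀ τ ∈ T K \ Bad K t, ∀ s ∈ (S K).filter (fun s => π K s = τ), 0 < p K t s)
    (hq : ∀ (K : ℕ) (t : ℝ), |t| ≤ l₀ → ∀ τ ∈ T K \ Bad K t, ∀ s ∈ (S K).filter (fun s => π K s = τ), 0 < q K t s) :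
    (∀ (K : ℕ) (t : ℝ), |t| ≤ l₀ → ∀ τ ∈ T K \ Bad K t, ∃ r : ℝ, ∀ s ∈ (S K).filter (fun s => π K s = τ),
      Real.exp (r - vol * ε K) * p K t s ≤ q K t s ∧ q K t s ≤ Real.exp (r + vol * ε K) * p K t s) ↔
    ∀ (K : ℕ) (t : ℝ), |t| ≤ l₀ → ∀ τ ∈ T K \ Bad K t, ∀ s ∈ (S K).filter (fun s => π K s = τ), ∀ s' ∈ (S K).filter (fun s => π K s = τ),
      (Real.log (q K t s) - Real.log (p K t s)) - (Real.log (q K t s') - Real.log (p K t s')) ≤ 2 * (vol * ε K) :=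
  ⟨fibreOsc_of_fibrewise hp, fibrewise_of_fibreOsc hp hq⟩

/-- **ASCENT FROM INTRA-FIBRE OSCILLATION** [folklore]: coarse `Core δ` for the fibre sums and intra-fibre oscillation `≤ 2·vol·ε_K` of the log-ratio of positive fine
cores ⇒ fine `Core (δ + 2ε)` at the pull-back bad class (§3 ∘ `fibrewise_of_fibreOsc`). -/
theorem core_of_core_classVal_of_fibreOsc [DecidableEq σ] (hmaps : ∀ K, ∀ s ∈ S K, π K s ∈ T K) (hp0 : ∀ (K : ℕ) (t : ℝ), |t| ≤ l₀ → ∀ s ∈ S K, 0 ≤ p K t s)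
    (hp : ∀ (K : ℕ) (t : ℝ), |t| ≤ l₀ → ∀ τ ∈ T K \ Bad K t, ∀ s ∈ (S K).filter (fun s => π K s = τ), 0 < p K t s)
    (hq : ∀ (K : ℕ) (t : ℝ), |t| ≤ l₀ → ∀ τ ∈ T K \ Bad K t, ∀ s ∈ (S K).filter (fun s => π K s = τ), 0 < q K t s)
    (hC : Core l₀ vol T Bad (classVal S π p) (classVal S π q) δ)
    (hosc : ∀ (K : ℕ) (t : ℝ), |t| ≤ l₀ → ∀ τ ∈ T K \ Bad K t, ∀ s ∈ (S K).filter (fun s => π K s = τ), ∀ s' ∈ (S K).filter (fun s => π K s = τ),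
      (Real.log (q K t s) - Real.log (p K t s)) - (Real.log (q K t s') - Real.log (p K t s')) ≤ 2 * (vol * ε K)) :
    Core l₀ vol S (fun K t => (S K).filter fun s => π K s ∈ Bad K t) p q (fun K => δ K + 2 * ε K) :=
  core_of_core_classVal hmaps hp0 hC (fibrewise_of_fibreOsc hp hq hosc)

end Oscillation

/-! ## §5 The collapse instance `σ → Unit`: matching of the TOTALS (t-uniform) + class-oscillation at each source value ⇒ `Core` [folklore] -/

section Collapse
variable [DecidableEq σ] {l₀ vol : ℝ} {S : ℕ → Finset σ} {p q : ℕ → ℝ → σ → ℝ} {δ ε : ℕ → ℝ}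

/-- **★★ WHAT `Core` ASKS BEYOND THE MATCHING OF THE TOTALS** [folklore].  Positive fine cores, (a) a ONE-CONSTANT, SOURCE-UNIFORM sandwich of the TOTALS
`e^{c_K − vol·δ_K}·Σ_S p ≤ Σ_S q ≤ e^{c_K + vol·δ_K}·Σ_S p` on `|t| ≤ l₀` (node U5's DECL-target currency `MatchingModConstants` read at one class), and (b) AT EACH SOURCE
VALUE SEPARATELY a class-oscillation of the log-ratio `≤ 2·vol·ε_K` ⇒ `Core l₀ vol S ∅ p q (δ + 2ε)` with the constants of the totals.  The collapse `π := (fun _ _ => ())`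
of §3–§4 (`N19RekeyingCalculus.classVal_collapse`), its pull-back bad class being empty.  Compare `N19CoreMetric.core_iff_logRatio_osc_le` (oscillation JOINT in `(t, τ)`):
here the source-uniformity is carried by the totals alone and the classes are asked to be homogeneous only source value by source value. -/
theorem core_of_totals_of_classOsc (hp : ∀ (K : ℕ) (t : ℝ), |t| ≤ l₀ → ∀ s ∈ S K, 0 < p K t s) (hq : ∀ (K : ℕ) (t : ℝ), |t| ≤ l₀ → ∀ s ∈ S K, 0 < q K t s)
    (hT : ∀ K : ℕ, ∃ c : ℝ, ∀ t : ℝ, |t| ≤ l₀ →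
      Real.exp (c - vol * δ K) * ∑ s ∈ S K, p K t s ≤ ∑ s ∈ S K, q K t s ∧ ∑ s ∈ S K, q K t s ≤ Real.exp (c + vol * δ K) * ∑ s ∈ S K, p K t s)
    (hosc : ∀ (K : ℕ) (t : ℝ), |t| ≤ l₀ → ∀ s ∈ S K, ∀ s' ∈ S K,
      (Real.log (q K t s) - Real.log (p K t s)) - (Real.log (q K t s') - Real.log (p K t s')) ≤ 2 * (vol * ε K)) :
    Core l₀ vol S (fun _ _ => ∅) p q (fun K => δ K + 2 * ε K) := by
  have hC : Core l₀ vol (fun _ => ({()} : Finset Unit)) (fun _ _ => ∅) (classVal S (fun _ _ => ()) p) (classVal S (fun _ _ => ()) q) δ := by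
    intro K
    obtain ⟨c, hc⟩ := hT K
    refine ⟨c, fun t ht u _ => ?_⟩
    obtain ⟨⟩ := u
    rw [classVal_collapse, classVal_collapse]
    exact hc t ht
  have hfine := core_of_core_classVal_of_fibreOsc (S := S) (T := fun _ => ({()} : Finset Unit)) (Bad := fun _ _ => ∅) (π := fun _ _ => ())
    (p := p) (q := q) (δ := δ) (ε := ε) (fun _ _ _ => Finset.mem_singleton_self _) (fun K t ht s hs => (hp K t ht s hs).le)
    (fun K t ht _ _ s hs => hp K t ht s (Finset.mem_filter.mp hs).1) (fun K t ht _ _ s hs => hq K t ht s (Finset.mem_filter.mp hs).1) hC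
    (fun K t ht _ _ s hs s' hs' => hosc K t ht s (Finset.mem_filter.mp hs).1 s' (Finset.mem_filter.mp hs').1)
  exact core_of_subset le_rfl (fun K t _ x hx => Finset.mem_sdiff.mpr
    ⟨(Finset.mem_sdiff.mp hx).1, fun h => Finset.notMem_empty _ (Finset.mem_filter.mp h).2⟩) hfine

/-- The edge form: source-uniform matching of the totals with SUMMABLE rate + per-source class-oscillation with SUMMABLE bound ⇒ N19's slot `∃ δ, Core … ∅ p q δ ∧ Summable δ`
[folklore]. -/
theorem coreEdge_of_totals_of_classOsc (hp : ∀ (K : ℕ) (t : ℝ), |t| ≤ l₀ → ∀ s ∈ S K, 0 < p K t s)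
    (hq : ∀ (K : ℕ) (t : ℝ), |t| ≤ l₀ → ∀ s ∈ S K, 0 < q K t s)
    (hT : ∃ δ : ℕ → ℝ, (∀ K : ℕ, ∃ c : ℝ, ∀ t : ℝ, |t| ≤ l₀ →
      Real.exp (c - vol * δ K) * ∑ s ∈ S K, p K t s ≤ ∑ s ∈ S K, q K t s ∧ ∑ s ∈ S K, q K t s ≤ Real.exp (c + vol * δ K) * ∑ s ∈ S K, p K t s) ∧ Summable δ)
    (hosc : ∃ ε : ℕ → ℝ, (∀ (K : ℕ) (t : ℝ), |t| ≤ l₀ → ∀ s ∈ S K, ∀ s' ∈ S K,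
      (Real.log (q K t s) - Real.log (p K t s)) - (Real.log (q K t s') - Real.log (p K t s')) ≤ 2 * (vol * ε K)) ∧ Summable ε) :
    ∃ δ : ℕ → ℝ, Core l₀ vol S (fun _ _ => ∅) p q δ ∧ Summable δ := by
  obtain ⟨δ, hT, hδ⟩ := hT
  obtain ⟨ε, hosc, hε⟩ := hosc
  exact ⟨fun K => δ K + 2 * ε K, core_of_totals_of_classOsc hp hq hT hosc, hδ.add (hε.mul_left 2)⟩

end Collapse

/-! ## §6 Gluing across a partition of the class set [folklore] -/

section Partwise
variable [DecidableEq σ] {l₀ vol : ℝ} {S : ℕ → Finset σ} {T : ℕ → Finset ι} {π : ℕ → σ → ι} {p q : ℕ → ℝ → σ → ℝ}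
  {Bad : ℕ → ℝ → Finset ι} {δ η : ℕ → ℝ}

/-- **★ PARTWISE `Core` GLUES IFF THE PART-SUMS MATCH MODULO ONE CONSTANT** (⇐ here; ⇒ is `fibrewise_of_core` ∕ Part I's `core_classVal`) [folklore].  Let the class set
be partitioned by `π K : S K → T K` and suppose `Core`-type sandwiches were produced SEPARATELY on every (coarse-good) part `π K ⁻¹ τ`, each with its OWN constant
`c_{K,τ}` uniform in the source (e.g. a small-field class matched termwise and a large-field-but-matched class, each by its own mechanism).  If the PART-SUMS match with
ONE constant per `K` (`Core` of the fibre sums at rate `η`), the parts glue to a global `Core (η + 2δ)` at the pull-back bad class, non-negative run-A terms assumed. -/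
theorem core_of_partwise (hmaps : ∀ K, ∀ s ∈ S K, π K s ∈ T K) (hp : ∀ (K : ℕ) (t : ℝ), |t| ≤ l₀ → ∀ s ∈ S K, 0 ≤ p K t s)
    (hparts : ∀ K : ℕ, ∀ τ ∈ T K, ∃ c : ℝ, ∀ t : ℝ, |t| ≤ l₀ → τ ∉ Bad K t → ∀ s ∈ (S K).filter (fun s => π K s = τ),
      Real.exp (c - vol * δ K) * p K t s ≤ q K t s ∧ q K t s ≤ Real.exp (c + vol * δ K) * p K t s)
    (hsums : Core l₀ vol T Bad (classVal S π p) (classVal S π q) η) :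
    Core l₀ vol S (fun K t => (S K).filter fun s => π K s ∈ Bad K t) p q (fun K => η K + 2 * δ K) :=
  core_of_core_classVal hmaps hp hsums fun K t ht τ hτ => by
    obtain ⟨c, hc⟩ := hparts K τ (Finset.mem_sdiff.mp hτ).1
    exact ⟨c, hc t ht (Finset.mem_sdiff.mp hτ).2⟩

end Partwise

/-! ## §7 The whole hybrid binder list ASCENDS at the same price [folklore] -/

section Hybrid
variable [DecidableEq σ] {l₀ vol : ℝ} {S : ℕ → Finset σ} {T : ℕ → Finset ι} {π : ℕ → σ → ι} {a b sha shb : ℕ → ℝ → σ → ℝ}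
  {Bad : ℕ → ℝ → Finset ι} {W Wsh δ ε : ℕ → ℝ}

/-- **★★ ASCENT OF `HybridNE7`** [folklore]: the hybrid binder list for the FIBRE SUMS at the coarse key (`classVal a`, `classVal b`, bad class `Bad`, shells `classVal sha`,
`classVal shb`, weights `W`, `Wsh`, rate `δ`), a class map into `T`, the fine termwise shell letters `0 ≤ sha ≤ a`, `0 ≤ shb ≤ b` on `S K`, and a SUMMABLE fibrewise letter
`Fib(ε)` for the fine CORES `a − sha`, `b − shb` on the coarse-good fibres ⇒ the hybrid binder list at the FINE key with bad class the pull-back `Bad♭`, the SAME `W`, `Wsh`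
and rate `δ + 2ε`: weight by Part I's `relWeightBound_of_classVal` (the pull-back is covered by construction), shell by §2, `lt_one` verbatim, core by §3 on the re-keyed
cores `classVal a − classVal sha = classVal (a − sha)` (Part I's `classVal_sub_fun`).  Of the five fields only `core` pays. -/
theorem hybridNE7_of_classVal (h : HybridNE7 l₀ vol T (classVal S π a) (classVal S π b) Bad W (classVal S π sha) (classVal S π shb) Wsh δ)
    (hmaps : ∀ K, ∀ s ∈ S K, π K s ∈ T K)
    (ha0 : ∀ (K : ℕ) (t : ℝ), |t| ≤ l₀ → ∀ s ∈ S K, 0 ≤ sha K t s) (ha1 : ∀ (K : ℕ) (t : ℝ), |t| ≤ l₀ → ∀ s ∈ S K, sha K t s ≤ a K t s)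
    (hb0 : ∀ (K : ℕ) (t : ℝ), |t| ≤ l₀ → ∀ s ∈ S K, 0 ≤ shb K t s) (hb1 : ∀ (K : ℕ) (t : ℝ), |t| ≤ l₀ → ∀ s ∈ S K, shb K t s ≤ b K t s)
    (hF : ∀ (K : ℕ) (t : ℝ), |t| ≤ l₀ → ∀ τ ∈ T K \ Bad K t, ∃ r : ℝ, ∀ s ∈ (S K).filter (fun s => π K s = τ),
      Real.exp (r - vol * ε K) * (a K t s - sha K t s) ≤ b K t s - shb K t s ∧ b K t s - shb K t s ≤ Real.exp (r + vol * ε K) * (a K t s - sha K t s))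
    (hε : Summable ε) :
    HybridNE7 l₀ vol S a b (fun K t => (S K).filter fun s => π K s ∈ Bad K t) W sha shb Wsh (fun K => δ K + 2 * ε K) where
  weight := relWeightBound_of_classVal h.weight hmaps (fun _ _ _ => Finset.filter_subset _ _) (fun _ _ _ _ _ hb => (Finset.mem_filter.mp hb).2)
    (fun K t ht s hs => (ha0 K t ht s hs).trans (ha1 K t ht s hs)) (fun K t ht s hs => (hb0 K t ht s hs).trans (hb1 K t ht s hs))
  shell := shellWeightBound_of_classVal h.shell hmaps ha0 ha1 hb0 hb1
  lt_one := h.lt_one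
  summable := h.summable.add (hε.mul_left 2)
  core := by
    have hc : Core l₀ vol T Bad (classVal S π fun K t s => a K t s - sha K t s) (classVal S π fun K t s => b K t s - shb K t s) δ := by
      rw [classVal_sub_fun S π a sha, classVal_sub_fun S π b shb]
      exact h.core
    exact core_of_core_classVal (p := fun K t s => a K t s - sha K t s) (q := fun K t s => b K t s - shb K t s) hmaps
      (fun K t ht s hs => sub_nonneg.mpr (ha1 K t ht s hs)) hc hF

end Hybrid

/-! ## §8 Sanity (kernel): the oscillation hypothesis of §5 on the two-class toy `q(true) = e^{u}`, `q(false) = e^{−u}`, `p ≡ 1` — the class gap `2u` exactly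
(with `u_K` not summably bounded this is g0's non-ascent witness `exists_totalCore_not_core`; with `u_K ≤ vol·ε_K` summable the ascent goes through) -/

example (u vol e : ℝ) (hu : u ≤ vol * e) :
    (Real.log (Real.exp u) - Real.log (1 : ℝ)) - (Real.log (Real.exp (-u)) - Real.log (1 : ℝ)) ≤ 2 * (vol * e) := by
  rw [Real.log_exp, Real.log_exp, Real.log_one]
  linarith

end Summit.QuantumFields.YangMills.BalabanUVNodes.N19RekeyingAscent

end
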